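import Literature.NumberTheory.Automorphic.WhittakerCoeffCuspidal
import Literature.NumberTheory.Automorphic.UnipotentTateDomain
import Literature.NumberTheory.Automorphic.AdeleAddCharUnramified
import Literature.NumberTheory.Automorphic.AdicCompletionResidueCard
import Literature.NumberTheory.Automorphic.JacquetShalikaSchurSelfSum
import Literature.NumberTheory.Automorphic.MeanSquareSchurGL2
import Literature.NumberTheory.Automorphic.IdelicDyadicUnfolding
import Literature.NumberTheory.Automorphic.GLnIwasawaIntegration
import Literature.NumberTheory.Automorphic.NormOneTorusAdelicCompact
import Literature.NumberTheory.Automorphic.AdelicVectorHeightCompact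
import Literature.NumberTheory.Automorphic.GJUnfoldingLocal
import Literature.NumberTheory.GaloisRepresentations.HeckeCharacterNormTwistProofs
import HarnessLib

/-!
# The unfolded Rankin–Selberg integral at a real point: the torus integral and its Euler lower bound

Topic `NumberTheory/Automorphic`; namespace `Literature.NumberTheory.Automorphic`. A brick of the
proof of the named fact `JacquetShalika1981_continuation_partialPairL_conj` of
`JacquetShalikaEulerProducts` (Jacquet–Shalika, *On Euler products and the classification of
automorphic representations I*, Amer. J. Math. **103** (1981), Lemma (5.2)) by the real-point
Rankin–Selberg method. In the tree the lemma is equivalent to the boundedness, uniformly in finite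
sets `F` of good places, of the partial products `∏_{v ∈ F} T_v(q_v^{-σ})` of the unramified
Rankin–Selberg torus sums `T_v(t) = ∑_λ |s_λ(x_v)|² t^{|λ|}` (`schurSelfSum`;
`JacquetShalikaSchurSelfSum`, `JacquetShalikaLargeFinsetProofs`, `PairLFunctionBaseChangeProofs`).
In print these products appear inside the Euler factorisation
`Ψ(s; W, W̄, Φ) = ∏_v Ψ_v(s; W_v, W̄_v, Φ_v)` of the unfolded global integral
`Ψ = ∫_{N_n(𝔸) \ GL_n(𝔸)} |W_φ(g)|² Φ(e_n g) |det g|^s dg` (Cogdell, *Analytic theory of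
L-functions for GL_n* (2004), §2.3, Thm. 2.2; Jacquet–Shalika (1981), §4), with
`Ψ_v = T_v(q_v^{-s})` at the unramified places by Shintani's formula and the Iwasawa decomposition
(loc. cit. §2, Prop. (2.3); Cogdell (2004), Thm. 3.3).

This file introduces the unfolded integral at a **real** point `σ`, written in torus coordinates
(the integrand being `N_n(𝔸)`-invariant in absolute value, the quotient by `N_n(𝔸)` is realised by
the Iwasawa coordinates `g = a k`, `a` diagonal, `k ∈ K = K_∞ GL_n(𝒪̂)`, with the Jacobian
`δ_B(a)⁻¹`):

  `rankinSelbergTorusIntegral νA νK W Φ σ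
     = ∫_{(𝔸ˣ)ⁿ × K} |W(diag(a) k)|² Φ(e_n diag(a) k) ∏_i ‖a_i‖^{σ - (n - 1 - 2 i)} dνA(a) dνK(k) ∈ [0, ∞]`

(**definition**; `∏_i ‖a_i‖^{σ-(n-1-2i)} = |det a|^σ δ_B(a)⁻¹`), and proves the **Euler lower
bound by positivity**, with no factorisation of `W`, no uniqueness of Whittaker models and no
convergence hypothesis:

* `setLIntegral_smul_unitBox_eq` — at a good place `v` (a place where `W` is an unramified
  Whittaker–Hecke datum in the variable `g_v`, `IsTorusUnramifiedAt`), translating the torus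
  variable by `ϖ_v^μ` multiplies the integral over the "unit box" by `|s_μ(x_v)|² q_v^{-|μ|σ}`
  (`s_μ` truncated to antitone `μ`; Shintani's formula `W(ι_v(ϖ^μ) g) = q_v^{-b(μ)/2} s_μ(x_v) W(g)`,
  `whittakerCoeff_ofLocal_piPowGL_eq` of `WhittakerCoeffLocalDatum`, the Jacobian `q_v^{b(μ)}` and
  `|det|^σ ↦ q_v^{-|μ|σ}`, and left invariance of the Haar measure of `(𝔸ˣ)ⁿ`:
  `torusIntegrand_localTorusPow_mul`);
* `schurSelfSum_mul_setLIntegral_le` — summing over the disjoint translates: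
  `T_v(q_v^{-σ}) · ∫_{B × K} ≤ ∫_{B' × K}` for the unit boxes `B' ⊇ ⊔_μ ϖ_v^μ B`
  (`schurSelfSum_eq_tsum`: the torus sum term by term);
* `prod_schurSelfSum_mul_setLIntegral_le_rankinSelbergTorusIntegral` (**main**): for every finite
  set `F` of good places,
  `(∏_{v ∈ F} T_v(q_v^{-σ})) · c ≤ rankinSelbergTorusIntegral νA νK W Φ σ`
  with `c = ∫_{B₀ × K} (integrand)` the integral over the box `B₀` of torus elements that are units
  at **all** good places — a constant independent of `F` (induction on `F`, one factor at a time).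

Consequently (`exists_prod_schurSelfSum_le_of_rankinSelbergTorusIntegral_ne_top`) finiteness of
the torus integral and positivity of `c` bound all the partial products, which is the currency of
`JacquetShalika1981_schurSelfSum_prod_bounded` (`JacquetShalikaSchurSelfSum`). Deliberately NOT here:
the finiteness (`Ψ(σ) ≤ C ∫ |φ|² E(·, Φ, σ) < ∞` — the unfolding inequality and the Eisenstein
side) and the positivity of `c` (genericity of cusp forms, continuity of `W`); they are the objects
of the sibling bricks.

The hypotheses on `W` are exactly what `WhittakerCoeffCuspidal` verifies for the global Whittaker
coefficient of a smoothed cuspidal vector (`exists_isTorusUnramifiedAt_whittakerCoeff_smoothedForm`),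
and the standard test function `Φ = Φ_∞ ⊗ 𝟙_{𝒪̂ⁿ}` (`standardTestFun`) is spherical at every finite
place, so the main theorem is instantiated for honest `L²`-cuspidal representations at the end of
the file (`exists_prod_schurSelfSum_le_of_cuspidal`).

Measurable structures: the idele group carries an abstract Borel structure
(`[MeasurableSpace (ideleGroup K)] [BorelSpace (ideleGroup K)]`, as in `IdelicDyadicUnfolding`), the
torus `(𝔸_Kˣ)ⁿ` the product structure, `GL_n(𝔸_K)` and `K` the local Borel structure `adelicBorel`
of `SmoothedAutomorphicForms`; the measures `νA`, `νK` are parameters (`νA` left invariant and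
s-finite, `νK` s-finite), intended to be Haar measures.

## References

* H. Jacquet, J. A. Shalika, *On Euler products and the classification of automorphic
  representations I*, Amer. J. Math. 103 (1981), 499–558: §2 Prop. (2.3), §4, Lemma (5.2) and
  Thm. (5.3) pp. 554–557 [JacquetShalikaAJM1981].
* J. W. Cogdell, *Analytic theory of L-functions for GL_n*, in: J. Bernstein, S. Gelbart (eds.),
  *An Introduction to the Langlands Program*, Birkhäuser (2004), §2.3 (Thm. 2.2), §3 (Thm. 3.3)
  [CogdellAnalyticTheory2004].
* T. Shintani, *On an explicit formula for class-1 "Whittaker functions" on `GL_n` over `P`-adic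
  fields*, Proc. Japan Acad. 52 (1976), 180–182 [Shintani1976].
-/

noncomputable section

open MeasureTheory Measure NumberField IsDedekindDomain Matrix Set Filter Finset
open scoped MatrixGroups ENNReal NNReal ComplexConjugate Pointwise
open Literature.RingTheory.SymmetricFunctions.SymmPoly
open Literature.NumberTheory.GaloisRepresentations (ideleGroup localUnits)

namespace Literature.NumberTheory.Automorphic

/-! ### Local diagonal elements as adelic torus elements -/

section Algebra

variable (n : ℕ) (K : Type) [Field K] [NumberField K] (v : HeightOneSpectrum (𝓞 K))

/-- The idele `localUnits v u = (u at v, 1 elsewhere)` is the adele `1 + ι_v(u - 1)`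
(`adeleSingleHom`, the non-unital inclusion `K_v → 𝔸_K`). [folklore] -/
theorem coe_localUnits_eq_one_add_adeleSingleHom (u : (v.adicCompletion K)ˣ) :
    ((localUnits v u : ideleGroup K) : AdeleRing (𝓞 K) K) =
      1 + adeleSingleHom K v ((u : v.adicCompletion K) - 1) := by
  refine Prod.ext ?_ ?_
  · change (1 : InfiniteAdeleRing K) = (1 : AdeleRing (𝓞 K) K).1 + (adeleSingleHom K v _).1
    rw [adeleSingleHom_apply_fst, add_zero]
    rfl
  · change ((localUnits v u : ideleGroup K) : AdeleRing (𝓞 K) K).2 =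
      (1 : AdeleRing (𝓞 K) K).2 + (adeleSingleHom K v _).2
    rw [adeleSingleHom_apply_snd]
    refine FiniteAdeleRing.ext K fun w => ?_
    change ((localUnits v u : ideleGroup K) : AdeleRing (𝓞 K) K).2 w =
      (1 : FiniteAdeleRing (𝓞 K) K) w + finiteAdeleSingleHom K v _ w
    by_cases hw : w = v
    · subst hw
      rw [GaloisRepresentations.localUnits_snd_apply_self, finiteAdeleSingleHom_apply_self]
      exact (add_sub_cancel (1 : HeightOneSpectrum.adicCompletion K _) _).symm
    · rw [finiteAdeleSingleHom_apply_of_ne K v _ hw, add_zero]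
      change (GaloisRepresentations.finiteAdeleSingle v (u : v.adicCompletion K)) w = 1
      exact GaloisRepresentations.finiteAdeleSingle_apply_of_ne _ hw

/-- **Local diagonal matrices are global torus elements**: `ι_v(diag(d)) = diag(localUnits v dᵢ)`
in `GL_n(𝔸_K)` (entrywise both are `1` at infinity and away from `v`, and `dᵢ` resp. `0` at `v`;
Godement–Jacquet, LNM 260, §10). [folklore] -/
theorem GLn.ofLocal_diagonalGL (d : Fin n → (v.adicCompletion K)ˣ) :
    GLn.ofLocal n K v (diagonalGL (Fin n) (v.adicCompletion K) d) =
      glDiagonal n (AdeleRing (𝓞 K) K) fun i => localUnits v (d i) := by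
  refine Matrix.GeneralLinearGroup.ext fun a b => ?_
  rw [GLn.coe_ofLocal_apply, coe_diagonalGL, coe_glDiagonal]
  by_cases hab : a = b
  · subst hab
    rw [Matrix.diagonal_apply_eq, Matrix.diagonal_apply_eq, Matrix.one_apply_eq,
      Matrix.one_apply_eq, coe_localUnits_eq_one_add_adeleSingleHom]
  · rw [Matrix.diagonal_apply_ne _ hab, Matrix.diagonal_apply_ne _ hab, Matrix.one_apply_ne hab,
      Matrix.one_apply_ne hab, sub_self, map_zero, add_zero]

variable {n K v}

/-- The torus element `ϖ^μ` at `v`: the `n`-tuple of ideles `(ϖ^{μ_i} at v, 1 elsewhere)`.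
[folklore] -/
def localTorusPow (ϖ : (v.adicCompletion K)ˣ) (mu : Fin n → ℕ) : Fin n → ideleGroup K :=
  fun i => localUnits v (ϖ ^ mu i)

/-- `diag(localTorusPow ϖ μ) = ι_v(ϖ^μ)` (`piPowGL` of `HeckeTransversalGL`). [folklore] -/
theorem glDiagonal_localTorusPow {ϖ : (v.adicCompletion K)ˣ} (hϖ : (ϖ : v.adicCompletion K) ≠ 0)
    (mu : Fin n → ℕ) :
    glDiagonal n (AdeleRing (𝓞 K) K) (localTorusPow ϖ mu) = GLn.ofLocal n K v (piPowGL hϖ mu) := by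
  rw [piPowGL_eq_diagonalGL, GLn.ofLocal_diagonalGL]
  congr 1
  funext i
  simp only [localTorusPow]
  congr 1
  ext
  simp

/-- The `w`-component of `localTorusPow ϖ μ i` is `1` for `w ≠ v`. [folklore] -/
theorem localTorusPow_snd_apply_of_ne (ϖ : (v.adicCompletion K)ˣ) (mu : Fin n → ℕ) (i : Fin n)
    {w : HeightOneSpectrum (𝓞 K)} (hw : w ≠ v) :
    ((localTorusPow ϖ mu i : ideleGroup K) : AdeleRing (𝓞 K) K).2 w = 1 := by
  change (GaloisRepresentations.finiteAdeleSingle v _) w = 1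
  exact GaloisRepresentations.finiteAdeleSingle_apply_of_ne _ hw

/-- The `v`-component of `localTorusPow ϖ μ i` is `ϖ^{μ_i}`. [folklore] -/
theorem localTorusPow_snd_apply_self (ϖ : (v.adicCompletion K)ˣ) (mu : Fin n → ℕ) (i : Fin n) :
    ((localTorusPow ϖ mu i : ideleGroup K) : AdeleRing (𝓞 K) K).2 v =
      ((ϖ ^ mu i : (v.adicCompletion K)ˣ) : v.adicCompletion K) := by
  change (GaloisRepresentations.finiteAdeleSingle v _) v = _
  exact GaloisRepresentations.finiteAdeleSingle_apply_self v _

/-- The archimedean component of `localTorusPow ϖ μ i` is `1`. [folklore] -/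
theorem localTorusPow_fst (ϖ : (v.adicCompletion K)ˣ) (mu : Fin n → ℕ) (i : Fin n) :
    ((localTorusPow ϖ mu i : ideleGroup K) : AdeleRing (𝓞 K) K).1 = 1 := rfl

/-- **The idele norm of `ϖ^{μ_i}`**: `‖localTorusPow ϖ μ i‖ = q_v^{-μ_i}` for a uniformizer in the
adelic normalisation `|ϖ|_v = exp(-1)` (`ideleNorm_localUnits`, `‖ϖ‖ = q_v⁻¹`). [folklore] -/
theorem ideleNorm_localTorusPow {ϖ : (v.adicCompletion K)ˣ}
    (hϖ : Valued.v (ϖ : v.adicCompletion K) = WithZero.exp (-1 : ℤ)) (mu : Fin n → ℕ) (i : Fin n) :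
    (IdeleClassGroup.ideleNorm K (localTorusPow ϖ mu i) : ℝ) = ((v.residueCard : ℝ)⁻¹) ^ mu i := by
  rw [coe_ideleNorm, localTorusPow, GaloisRepresentations.ideleNorm_localUnits, Units.val_pow_eq_pow_val,
    norm_pow, norm_eq_inv_residueCard_of_valued_eq hϖ]

end Algebra

/-! ### The torus integral -/

section TorusIntegral

variable (n : ℕ) (K : Type) [Field K] [NumberField K]

/-- The last standard basis row vector `e_n = (0, …, 0, 1) ∈ 𝔸_Kⁿ` (for `n = 0` the empty
vector). [folklore] -/
def lastBasisVec : Fin n → AdeleRing (𝓞 K) K := fun i => if (i : ℕ) + 1 = n then 1 else 0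

/-- The **torus weight** `∏_i ‖a_i‖^{σ - (n - 1 - 2 i)} = |det a|^σ · δ_B(a)⁻¹` of a diagonal torus
element `a = diag(a_0, …, a_{n-1})` (`δ_B(a) = ∏_{i<j} ‖a_i / a_j‖ = ∏_i ‖a_i‖^{n-1-2i}`, the
modulus of the upper triangular Borel subgroup; real powers of the positive reals `‖a_i‖`).
[folklore] -/
def torusWeight (σ : ℝ) (a : Fin n → ideleGroup K) : ℝ :=
  ∏ i : Fin n, (IdeleClassGroup.ideleNorm K (a i) : ℝ) ^ (σ - ((n : ℝ) - 1 - 2 * (i : ℕ)))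

variable {n K} in
/-- The torus weight is non-negative. [folklore] -/
theorem torusWeight_nonneg (σ : ℝ) (a : Fin n → ideleGroup K) : 0 ≤ torusWeight n K σ a :=
  Finset.prod_nonneg fun _ _ => Real.rpow_nonneg (NNReal.coe_nonneg _) _

/-- The point `diag(a) · k ∈ GL_n(𝔸_K)` with torus coordinate `a ∈ (𝔸_Kˣ)ⁿ` and compact
coordinate `k ∈ K`. [folklore] -/
def torusPoint (p : (Fin n → ideleGroup K) × ↥(maximalCompactAdelic n K)) :
    GL (Fin n) (AdeleRing (𝓞 K) K) :=
  glDiagonal n (AdeleRing (𝓞 K) K) p.1 *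
    (show GL (Fin n) (AdeleRing (𝓞 K) K) from (p.2 : (AdelicGroupData.gl n K).Adelic))

/-- The row vector `e_n g`, the last row of `g`. [folklore] -/
def lastRow (g : GL (Fin n) (AdeleRing (𝓞 K) K)) : Fin n → AdeleRing (𝓞 K) K :=
  lastBasisVec n K ᵥ* (g : Matrix (Fin n) (Fin n) (AdeleRing (𝓞 K) K))

/-- The **integrand of the unfolded Rankin–Selberg integral at a real point** in torus
coordinates: `(a, k) ↦ |W(diag(a) k)|² Φ(e_n diag(a) k) |det a|^σ δ_B(a)⁻¹ ∈ [0, ∞]`.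
[folklore] -/
def torusIntegrand (W : GL (Fin n) (AdeleRing (𝓞 K) K) → ℂ) (Φ : (Fin n → AdeleRing (𝓞 K) K) → ℝ)
    (σ : ℝ) (p : (Fin n → ideleGroup K) × ↥(maximalCompactAdelic n K)) : ℝ≥0∞ :=
  ENNReal.ofReal (‖W (torusPoint n K p)‖ ^ 2 * Φ (lastRow n K (torusPoint n K p)) *
    torusWeight n K σ p.1)

variable [MeasurableSpace (ideleGroup K)] [MeasurableSpace (AdelicGroupData.gl n K).Adelic]

/-- **The unfolded Rankin–Selberg integral at a real point `σ`, in torus coordinates**: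
`Ψ(σ; W, W̄, Φ) = ∫_{(𝔸ˣ)ⁿ × K} |W(diag(a) k)|² Φ(e_n diag(a) k) |det a|^σ δ_B(a)⁻¹ dνA(a) dνK(k)`,
an integral in `[0, ∞]` against a measure `νA` on the torus `(𝔸_Kˣ)ⁿ` (intended: the product of
Haar measures) and a measure `νK` on the maximal compact subgroup `K = K_∞ GL_n(𝒪̂_K)` (intended:
Haar). This is `∫_{N_n(𝔸) \ GL_n(𝔸)} W(g) W̄(g) Φ(e_n g) |det g|^σ dg` of Cogdell (2004), §2.3 /
Jacquet–Shalika (1981), §4 for `W' = W̄` at the real point `s = σ`, written through the Iwasawa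
decomposition `GL_n(𝔸) = N A K`, `dg = du δ_B(a)⁻¹ da dk`, the compact `u`-integral of the
`N_n(𝔸)`-invariant integrand `|W(u a k)|² = |W(a k)|²` being absorbed in the normalisation.
[cite: CogdellAnalyticTheory2004, §2.3] -/
def rankinSelbergTorusIntegral (νA : Measure (Fin n → ideleGroup K))
    (νK : Measure ↥(maximalCompactAdelic n K)) (W : GL (Fin n) (AdeleRing (𝓞 K) K) → ℂ)
    (Φ : (Fin n → AdeleRing (𝓞 K) K) → ℝ) (σ : ℝ) : ℝ≥0∞ :=
  ∫⁻ p, torusIntegrand n K W Φ σ p ∂(νA.prod νK)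

end TorusIntegral

/-! ### Unramified data at a finite place -/

section Unramified

variable (n : ℕ) (K : Type) [Field K] [NumberField K]

/-- **`W` is an unramified Whittaker–Hecke datum at `v` in its `v`-variable**, with uniformizer `ϖ`
(adelic normalisation `|ϖ|_v = exp(-1)`) and parameters `x ∈ ℂⁿ`: `W` is right invariant under
`ι_v(GL_n(𝒪_v))`, and for every `g ∈ GL_n(𝔸_K)` with trivial `v`-component and every `μ ∈ ℕⁿ`,
`W(ι_v(ϖ^μ) g) = q_v^{-b(μ)/2} s_μ(x) W(g)`, `s_μ` the Schur polynomial truncated to antitone `μ`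
(Shintani's formula together with the vanishing off the antitone cone). For the global Whittaker
coefficient of a smoothed cuspidal vector at a good place this is
`isTorusUnramifiedAt_whittakerCoeff_smoothedForm` below (`WhittakerCoeffCuspidal`,
`WhittakerCoeffLocalDatum`). [folklore] -/
structure IsTorusUnramifiedAt (W : GL (Fin n) (AdeleRing (𝓞 K) K) → ℂ) (v : HeightOneSpectrum (𝓞 K))
    (ϖ : (v.adicCompletion K)ˣ) (x : Fin n → ℂ) : Prop where
  valued_eq : Valued.v (ϖ : v.adicCompletion K) = WithZero.exp (-1 : ℤ)
  spherical : ∀ k ∈ glInt n (v.adicCompletion K), ∀ g, W (g * GLn.ofLocal n K v k) = W g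
  shintani : ∀ g : GL (Fin n) (AdeleRing (𝓞 K) K),
    Matrix.GeneralLinearGroup.map (AdelicGroupData.adeleEval K v) g = 1 → ∀ mu : Fin n → ℕ,
      W (GLn.ofLocal n K v (piPowGL ϖ.ne_zero mu) * g) =
        (((Real.sqrt (v.residueCard : ℝ) : ℝ) : ℂ)) ^ (-torusExponent mu) * schurTrunc x mu * W g

/-- **`Φ` is spherical at `v` on integral vectors**: multiplying a row vector that is integral at `v`
by an adele which is `1` off `v` and a non-zero integer at `v` does not change `Φ`. This holds for
the standard choice `Φ = Φ_∞ ⊗ 𝟙_{𝒪̂ⁿ}` (`IsLastRowSphericalAt.of_indicator` below) and, more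
generally, for factorizable Schwartz–Bruhat functions with `Φ_v = 𝟙_{𝒪_vⁿ}`. [folklore] -/
structure IsLastRowSphericalAt (Φ : (Fin n → AdeleRing (𝓞 K) K) → ℝ) (v : HeightOneSpectrum (𝓞 K)) :
    Prop where
  smul_eq : ∀ (c : AdeleRing (𝓞 K) K) (y : Fin n → AdeleRing (𝓞 K) K), c.1 = 1 →
    (∀ w, w ≠ v → c.2 w = 1) → Valued.v (c.2 v) ≤ 1 → c.2 v ≠ 0 →
    (∀ i, Valued.v ((y i).2 v) ≤ 1) → Φ (c • y) = Φ y

variable {n K}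
variable {W : GL (Fin n) (AdeleRing (𝓞 K) K) → ℂ} {Φ : (Fin n → AdeleRing (𝓞 K) K) → ℝ}
  {v : HeightOneSpectrum (𝓞 K)} {ϖ : (v.adicCompletion K)ˣ} {x : Fin n → ℂ}

/-- The `v`-component of `g ∈ GL_n(𝔸_K)` (as an element of `GL_n(K_v)`). [folklore] -/
abbrev localComponent (v : HeightOneSpectrum (𝓞 K)) (g : GL (Fin n) (AdeleRing (𝓞 K) K)) :
    GL (Fin n) (v.adicCompletion K) :=
  Matrix.GeneralLinearGroup.map (AdelicGroupData.adeleEval K v) g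

/-- Stripping the `v`-component: `g · ι_v(g_v)⁻¹` has trivial `v`-component. [folklore] -/
theorem localComponent_mul_ofLocal_inv (g : GL (Fin n) (AdeleRing (𝓞 K) K)) :
    localComponent v (g * GLn.ofLocal n K v (localComponent v g)⁻¹) = 1 := by
  have h : localComponent v (GLn.ofLocal n K v (localComponent v g)) = localComponent v g :=
    GLn.toLocal_ofLocal (localComponent v g)
  have hmul : localComponent v (g * GLn.ofLocal n K v (localComponent v g)⁻¹) =
      localComponent v g * (localComponent v (GLn.ofLocal n K v (localComponent v g)))⁻¹ := by
    simp only [localComponent, map_mul, map_inv]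
  rw [hmul, h, mul_inv_cancel]

/-- **Shintani's formula with an integral `v`-component**: if `g_v ∈ GL_n(𝒪_v)` then
`W(ι_v(ϖ^μ) g) = q_v^{-b(μ)/2} s_μ(x) W(g)` (strip `g_v` to the right by sphericity, apply the
formula at the element with trivial `v`-component, put `g_v` back). [folklore] -/
theorem IsTorusUnramifiedAt.apply_ofLocal_piPowGL_mul (hW : IsTorusUnramifiedAt n K W v ϖ x)
    {g : GL (Fin n) (AdeleRing (𝓞 K) K)} (hg : localComponent v g ∈ glInt n (v.adicCompletion K))
    (mu : Fin n → ℕ) :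
    W (GLn.ofLocal n K v (piPowGL ϖ.ne_zero mu) * g) =
      (((Real.sqrt (v.residueCard : ℝ) : ℝ) : ℂ)) ^ (-torusExponent mu) * schurTrunc x mu * W g := by
  set g' := g * GLn.ofLocal n K v (localComponent v g)⁻¹ with hg'
  have hg'1 : Matrix.GeneralLinearGroup.map (AdelicGroupData.adeleEval K v) g' = 1 :=
    localComponent_mul_ofLocal_inv g
  have hgg' : g = g' * GLn.ofLocal n K v (localComponent v g) := by
    rw [hg', mul_assoc, ← map_mul, inv_mul_cancel, map_one, mul_one]
  rw [hgg', ← mul_assoc, hW.spherical _ hg, hW.spherical _ hg, hW.shintani g' hg'1 mu]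

/-- The norm of the Shintani factor: `‖q^{-b/2} s_μ‖² · q^{b} = ‖s_μ‖²` bookkeeping, first half:
`‖(√q)^{-b} · s · w‖² = q^{-b} ‖s‖² ‖w‖²` with `q^{-b}` a real `zpow`. [folklore] -/
theorem norm_sqrt_zpow_mul_mul_sq {q : ℝ} (hq : 0 < q) (b : ℤ) (s w : ℂ) :
    ‖(((Real.sqrt q : ℝ) : ℂ)) ^ (-b) * s * w‖ ^ 2 = q ^ (-b) * (‖s‖ ^ 2 * ‖w‖ ^ 2) := by
  have h2 : (Real.sqrt q ^ (-b)) ^ 2 = q ^ (-b) := by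
    rw [← zpow_natCast, ← _root_.zpow_mul, mul_comm, _root_.zpow_mul, zpow_natCast,
      Real.sq_sqrt hq.le]
  rw [norm_mul, norm_mul, norm_zpow, Complex.norm_real, Real.norm_of_nonneg (Real.sqrt_nonneg q),
    mul_pow, mul_pow, h2]
  ring

end Unramified

/-! ### Translating the torus variable by `ϖ_v^μ` -/

section Translation

variable {n : ℕ} {K : Type} [Field K] [NumberField K]

/-- `diag(t a) k = diag(t) · (diag(a) k)`. [folklore] -/
theorem torusPoint_mul (t a : Fin n → ideleGroup K) (k : ↥(maximalCompactAdelic n K)) :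
    torusPoint n K (t * a, k) = glDiagonal n (AdeleRing (𝓞 K) K) t * torusPoint n K (a, k) := by
  simp only [torusPoint, map_mul, mul_assoc]

/-- The last entry `t_{n-1}` of a torus element (`1` for `n = 0`). [folklore] -/
def lastEntry (t : Fin n → ideleGroup K) : ideleGroup K :=
  if h : 0 < n then t ⟨n - 1, Nat.sub_lt h one_pos⟩ else 1

/-- `e_n · diag(d) = d_{n-1} e_n`. [folklore] -/
theorem lastBasisVec_vecMul_diagonal (d : Fin n → AdeleRing (𝓞 K) K) :
    lastBasisVec n K ᵥ* Matrix.diagonal d =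
      (if h : 0 < n then d ⟨n - 1, Nat.sub_lt h one_pos⟩ else 1) • lastBasisVec n K := by
  funext j
  rw [Matrix.vecMul_diagonal, Pi.smul_apply, smul_eq_mul]
  by_cases hj : (j : ℕ) + 1 = n
  · have hn : 0 < n := by omega
    have hlast : (⟨n - 1, Nat.sub_lt hn one_pos⟩ : Fin n) = j := Fin.ext (by simp only; omega)
    simp only [lastBasisVec, hj, if_true, dif_pos hn, hlast, one_mul, mul_one]
  · simp only [lastBasisVec, hj, if_false, zero_mul, mul_zero]

/-- **The last row of `diag(t) g` is `t_{n-1}` times the last row of `g`.** [folklore] -/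
theorem lastRow_glDiagonal_mul (t : Fin n → ideleGroup K) (g : GL (Fin n) (AdeleRing (𝓞 K) K)) :
    lastRow n K (glDiagonal n (AdeleRing (𝓞 K) K) t * g) =
      ((lastEntry t : ideleGroup K) : AdeleRing (𝓞 K) K) • lastRow n K g := by
  rw [lastRow, lastRow, Matrix.GeneralLinearGroup.coe_mul, coe_glDiagonal, ← Matrix.vecMul_vecMul,
    lastBasisVec_vecMul_diagonal, Matrix.smul_vecMul]
  congr 1
  unfold lastEntry
  split_ifs <;> rfl

/-- The torus weight is multiplicative. [folklore] -/
theorem torusWeight_mul (σ : ℝ) (t a : Fin n → ideleGroup K) :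
    torusWeight n K σ (t * a) = torusWeight n K σ t * torusWeight n K σ a := by
  unfold torusWeight
  rw [← Finset.prod_mul_distrib]
  refine Finset.prod_congr rfl fun i _ => ?_
  rw [Pi.mul_apply, map_mul, NNReal.coe_mul, Real.mul_rpow (NNReal.coe_nonneg _) (NNReal.coe_nonneg _)]

variable {v : HeightOneSpectrum (𝓞 K)} {ϖ : (v.adicCompletion K)ˣ}

/-- `∑_i -(μ_i (σ - (n-1-2i))) = b(μ) - σ |μ|` with `b = torusExponent`. [folklore] -/
theorem sum_neg_mul_weightExponent (σ : ℝ) (mu : Fin n → ℕ) :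
    ∑ i : Fin n, -((mu i : ℝ) * (σ - ((n : ℝ) - 1 - 2 * (i : ℕ)))) =
      (torusExponent mu : ℝ) - σ * ∑ i, (mu i : ℝ) := by
  simp only [torusExponent, Int.cast_sum, Int.cast_mul, Int.cast_natCast, Int.cast_sub, Int.cast_one,
    Int.cast_ofNat, Finset.mul_sum, ← Finset.sum_sub_distrib]
  refine Finset.sum_congr rfl fun i _ => ?_
  ring

/-- **The torus weight of `ϖ^μ`**: `|det ϖ^μ|^σ δ_B(ϖ^μ)⁻¹ = q_v^{b(μ) - σ|μ|}`. [folklore] -/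
theorem torusWeight_localTorusPow (hϖ : Valued.v (ϖ : v.adicCompletion K) = WithZero.exp (-1 : ℤ))
    (σ : ℝ) (mu : Fin n → ℕ) :
    torusWeight n K σ (localTorusPow ϖ mu) =
      (v.residueCard : ℝ) ^ ((torusExponent mu : ℝ) - σ * ∑ i, (mu i : ℝ)) := by
  have hq : (0 : ℝ) < v.residueCard := by exact_mod_cast zero_lt_one.trans v.one_lt_residueCard
  unfold torusWeight
  rw [← sum_neg_mul_weightExponent, Real.rpow_sum_of_pos hq]
  refine Finset.prod_congr rfl fun i _ => ?_
  rw [ideleNorm_localTorusPow hϖ, ← Real.rpow_natCast, Real.inv_rpow hq.le, ← Real.rpow_neg hq.le,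
    ← Real.rpow_mul hq.le, neg_mul]

/-- The components of the idele `lastEntry (localTorusPow ϖ μ)`: `1` at infinity and off `v`, a
power of `ϖ` at `v`. [folklore] -/
theorem lastEntry_localTorusPow (ϖ : (v.adicCompletion K)ˣ) (mu : Fin n → ℕ) :
    ((lastEntry (localTorusPow ϖ mu) : ideleGroup K) : AdeleRing (𝓞 K) K).1 = 1 ∧
      (∀ w, w ≠ v → ((lastEntry (localTorusPow ϖ mu) : ideleGroup K) : AdeleRing (𝓞 K) K).2 w = 1) ∧
      ∃ m : ℕ, ((lastEntry (localTorusPow ϖ mu) : ideleGroup K) : AdeleRing (𝓞 K) K).2 v =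
        ((ϖ ^ m : (v.adicCompletion K)ˣ) : v.adicCompletion K) := by
  unfold lastEntry
  split_ifs with h
  · exact ⟨localTorusPow_fst ϖ mu _, fun w hw => localTorusPow_snd_apply_of_ne ϖ mu _ hw,
      mu ⟨n - 1, Nat.sub_lt h one_pos⟩, localTorusPow_snd_apply_self ϖ mu _⟩
  · exact ⟨rfl, fun w _ => rfl, 0, by rw [pow_zero]; rfl⟩

end Translation

/-! ### Integrality of the `v`-component on the unit box -/

section Integrality

variable {n : ℕ} {K : Type} [Field K] [NumberField K] {v : HeightOneSpectrum (𝓞 K)}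

/-- An element of `GL_n(𝔸_K)` whose entries and whose inverse's entries are integral at `v` has
`v`-component in `GL_n(𝒪_v)`. [folklore] -/
theorem localComponent_mem_glInt {g : GL (Fin n) (AdeleRing (𝓞 K) K)}
    (h : ∀ i j, Valued.v (((g : Matrix (Fin n) (Fin n) (AdeleRing (𝓞 K) K)) i j).2 v) ≤ 1)
    (h' : ∀ i j, Valued.v ((((g⁻¹ : GL (Fin n) (AdeleRing (𝓞 K) K)) :
      Matrix (Fin n) (Fin n) (AdeleRing (𝓞 K) K)) i j).2 v) ≤ 1) :
    localComponent v g ∈ glInt n (v.adicCompletion K) := by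
  rw [mem_glInt_iff]
  refine ⟨fun i j => ?_, fun i j => ?_⟩
  · rw [mem_integer_adicCompletion_iff, localComponent, AdelicGroupData.coe_map_adeleEval_apply,
      AdelicGroupData.adeleEval_apply]
    exact h i j
  · rw [mem_integer_adicCompletion_iff, localComponent, ← map_inv,
      AdelicGroupData.coe_map_adeleEval_apply, AdelicGroupData.adeleEval_apply]
    exact h' i j

/-- For `k` in the maximal compact subgroup `K = K_∞ GL_n(𝒪̂_K)`, the `v`-component lies in
`GL_n(𝒪_v)`. [folklore] -/
theorem localComponent_mem_glInt_of_mem_maximalCompactAdelic {k : GL (Fin n) (AdeleRing (𝓞 K) K)}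
    (hk : k ∈ maximalCompactAdelic n K) : localComponent v k ∈ glInt n (v.adicCompletion K) := by
  refine localComponent_mem_glInt (fun i j => ?_) (fun i j => ?_)
  · exact (HeightOneSpectrum.mem_adicCompletionIntegers _ _ _).1
      (snd_apply_mem_of_mem_standardMaximalCompactGL hk v i j).1
  · exact (HeightOneSpectrum.mem_adicCompletionIntegers _ _ _).1
      (snd_apply_mem_of_mem_standardMaximalCompactGL hk v i j).2

/-- For a torus element `a` all of whose entries are units at `v`, the `v`-component of `diag(a)`
lies in `GL_n(𝒪_v)`. [folklore] -/
theorem localComponent_glDiagonal_mem_glInt {a : Fin n → ideleGroup K}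
    (ha : ∀ i, Valued.v (((a i : ideleGroup K) : AdeleRing (𝓞 K) K).2 v) = 1) :
    localComponent v (glDiagonal n (AdeleRing (𝓞 K) K) a) ∈ glInt n (v.adicCompletion K) := by
  have hdiag : ∀ (b : Fin n → ideleGroup K),
      (∀ i, Valued.v (((b i : ideleGroup K) : AdeleRing (𝓞 K) K).2 v) ≤ 1) → ∀ i j,
        Valued.v (((glDiagonal n (AdeleRing (𝓞 K) K) b : Matrix (Fin n) (Fin n) (AdeleRing (𝓞 K) K))
          i j).2 v) ≤ 1 := by
    intro b hb i j
    rw [coe_glDiagonal]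
    by_cases hij : i = j
    · subst hij
      rw [Matrix.diagonal_apply_eq]
      exact hb i
    · rw [Matrix.diagonal_apply_ne _ hij]
      change Valued.v ((0 : FiniteAdeleRing (𝓞 K) K) v) ≤ 1
      rw [show (0 : FiniteAdeleRing (𝓞 K) K) v = 0 from rfl, map_zero]
      exact zero_le
  refine localComponent_mem_glInt (hdiag a fun i => (ha i).le) ?_
  rw [← map_inv]
  refine hdiag a⁻¹ fun i => ?_
  rw [Pi.inv_apply]
  have h : (((a i)⁻¹ : ideleGroup K) : AdeleRing (𝓞 K) K).2 v =
      ((((a i : ideleGroup K) : AdeleRing (𝓞 K) K).2 v))⁻¹ :=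
    map_units_inv ((AdelicGroupData.adeleEval K v : AdeleRing (𝓞 K) K →+* v.adicCompletion K) :
      AdeleRing (𝓞 K) K →* v.adicCompletion K) (a i)
  rw [h, map_inv₀, ha i, inv_one]

/-- On the unit box at `v`, the point `diag(a) k` has `v`-component in `GL_n(𝒪_v)`. [folklore] -/
theorem localComponent_torusPoint_mem_glInt {a : Fin n → ideleGroup K}
    (ha : ∀ i, Valued.v (((a i : ideleGroup K) : AdeleRing (𝓞 K) K).2 v) = 1)
    (k : ↥(maximalCompactAdelic n K)) :
    localComponent v (torusPoint n K (a, k)) ∈ glInt n (v.adicCompletion K) := by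
  rw [torusPoint, localComponent, map_mul]
  exact Subgroup.mul_mem _ (localComponent_glDiagonal_mem_glInt ha)
    (localComponent_mem_glInt_of_mem_maximalCompactAdelic k.2)

/-- The entries of an element of `GL_n(𝒪_v)` (as `v`-component) are integral: the last row of
`diag(a) k` is integral at `v` on the unit box. [folklore] -/
theorem valued_lastRow_torusPoint_le_one {a : Fin n → ideleGroup K}
    (ha : ∀ i, Valued.v (((a i : ideleGroup K) : AdeleRing (𝓞 K) K).2 v) = 1)
    (k : ↥(maximalCompactAdelic n K)) (j : Fin n) :
    Valued.v ((lastRow n K (torusPoint n K (a, k)) j).2 v) ≤ 1 := by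
  have hmem := (mem_glInt_iff _).1 (localComponent_torusPoint_mem_glInt ha k)
  -- the last row of `g` is `∑_i e_i g_{ij} = g_{n-1, j}` (or empty)
  rw [lastRow, Matrix.vecMul, dotProduct]
  change Valued.v ((AdelicGroupData.adeleEval K v) (∑ i, lastBasisVec n K i *
    (torusPoint n K (a, k) : Matrix (Fin n) (Fin n) (AdeleRing (𝓞 K) K)) i j)) ≤ 1
  rw [_root_.map_sum]
  refine Valuation.map_sum_le _ fun i _ => ?_
  rw [map_mul]
  refine (Valuation.map_mul _ _ _).le.trans (mul_le_one' ?_ ?_)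
  · simp only [lastBasisVec]
    split_ifs
    · rw [map_one, map_one]
    · rw [map_zero, map_zero]; exact zero_le
  · have h := hmem.1 i j
    rw [mem_integer_adicCompletion_iff, localComponent, AdelicGroupData.coe_map_adeleEval_apply] at h
    exact h

end Integrality

/-! ### The integrand on a translate of the unit box -/

section Pointwise

variable {n : ℕ} {K : Type} [Field K] [NumberField K] {v : HeightOneSpectrum (𝓞 K)}
  {ϖ : (v.adicCompletion K)ˣ} {x : Fin n → ℂ}
  {W : GL (Fin n) (AdeleRing (𝓞 K) K) → ℂ} {Φ : (Fin n → AdeleRing (𝓞 K) K) → ℝ}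

/-- The **local Rankin–Selberg coefficient** `|s_μ(x)|² q_v^{-σ|μ|} ∈ [0, ∞]` — the term of the
torus sum `T_v(q_v^{-σ})` (`schurSelfSum`) indexed by the weight `μ`. [folklore] -/
def localCoeff (v : HeightOneSpectrum (𝓞 K)) (x : Fin n → ℂ) (σ : ℝ) (mu : Fin n → ℕ) : ℝ≥0∞ :=
  ENNReal.ofReal (‖schurTrunc x mu‖ ^ 2 * (v.residueCard : ℝ) ^ (-(σ * ∑ i, (mu i : ℝ))))

/-- **The integrand on the translate `ϖ_v^μ · a` of a point `a` of the unit box.** If `W` is an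
unramified Whittaker–Hecke datum at `v` with parameters `x` and `Φ` is spherical at `v`, then for `a`
with unit entries at `v` and `k ∈ K`,
`I(ϖ^μ a, k) = |s_μ(x)|² q_v^{-σ|μ|} · I(a, k)`:
Shintani's formula contributes `q_v^{-b(μ)} |s_μ(x)|²` to `|W|²`, the Jacobian `δ_B⁻¹ |det|^σ`
contributes `q_v^{b(μ) - σ|μ|}`, and `Φ(e_n ·)` does not change (Jacquet–Shalika (1981), §2;
Cogdell (2004), proof of Thm. 3.3). [folklore] -/
theorem torusIntegrand_localTorusPow_mul (hW : IsTorusUnramifiedAt n K W v ϖ x)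
    (hΦ : IsLastRowSphericalAt n K Φ v) (σ : ℝ) (mu : Fin n → ℕ) {a : Fin n → ideleGroup K}
    (ha : ∀ i, Valued.v (((a i : ideleGroup K) : AdeleRing (𝓞 K) K).2 v) = 1)
    (k : ↥(maximalCompactAdelic n K)) :
    torusIntegrand n K W Φ σ (localTorusPow ϖ mu * a, k) =
      localCoeff v x σ mu * torusIntegrand n K W Φ σ (a, k) := by
  have hq : (0 : ℝ) < v.residueCard := by exact_mod_cast zero_lt_one.trans v.one_lt_residueCard
  set g := torusPoint n K (a, k) with hg
  have hpt : torusPoint n K (localTorusPow ϖ mu * a, k) = GLn.ofLocal n K v (piPowGL ϖ.ne_zero mu) * g := by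
    rw [torusPoint_mul, glDiagonal_localTorusPow]
  -- Shintani
  have hW' : W (torusPoint n K (localTorusPow ϖ mu * a, k)) =
      (((Real.sqrt (v.residueCard : ℝ) : ℝ) : ℂ)) ^ (-torusExponent mu) * schurTrunc x mu * W g := by
    rw [hpt]
    exact hW.apply_ofLocal_piPowGL_mul (localComponent_torusPoint_mem_glInt ha k) mu
  -- `Φ(e_n ·)` is unchanged
  have hΦ' : Φ (lastRow n K (torusPoint n K (localTorusPow ϖ mu * a, k))) = Φ (lastRow n K g) := by
    rw [torusPoint_mul, lastRow_glDiagonal_mul]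
    obtain ⟨h1, h2, m, h3⟩ := lastEntry_localTorusPow (n := n) ϖ mu
    refine hΦ.smul_eq _ _ h1 h2 ?_ ?_ (valued_lastRow_torusPoint_le_one ha k)
    · rw [h3, Units.val_pow_eq_pow_val, map_pow, hW.valued_eq, ← WithZero.exp_nsmul, ← WithZero.exp_zero,
        WithZero.exp_le_exp]
      simp
    · rw [h3]
      exact Units.ne_zero _
  -- the Jacobian
  have hwt : torusWeight n K σ (localTorusPow ϖ mu * a) =
      (v.residueCard : ℝ) ^ ((torusExponent mu : ℝ) - σ * ∑ i, (mu i : ℝ)) * torusWeight n K σ a := by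
    rw [torusWeight_mul, torusWeight_localTorusPow hW.valued_eq]
  -- combine the powers of `q_v`
  have hpow : (v.residueCard : ℝ) ^ (-torusExponent mu) *
      (v.residueCard : ℝ) ^ ((torusExponent mu : ℝ) - σ * ∑ i, (mu i : ℝ)) =
        (v.residueCard : ℝ) ^ (-(σ * ∑ i, (mu i : ℝ))) := by
    rw [← Real.rpow_intCast, ← Real.rpow_add hq]
    congr 1
    push_cast
    ring
  have hnn : 0 ≤ ‖schurTrunc x mu‖ ^ 2 * (v.residueCard : ℝ) ^ (-(σ * ∑ i, (mu i : ℝ))) :=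
    mul_nonneg (sq_nonneg _) (Real.rpow_nonneg hq.le _)
  simp only [torusIntegrand, localCoeff]
  rw [← hg, hW', hΦ', hwt, norm_sqrt_zpow_mul_mul_sq hq, ← ENNReal.ofReal_mul hnn]
  congr 1
  calc (v.residueCard : ℝ) ^ (-torusExponent mu) * (‖schurTrunc x mu‖ ^ 2 * ‖W g‖ ^ 2) *
        Φ (lastRow n K g) * ((v.residueCard : ℝ) ^ ((torusExponent mu : ℝ) - σ * ∑ i, (mu i : ℝ)) *
          torusWeight n K σ a)
      = ((v.residueCard : ℝ) ^ (-torusExponent mu) *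
          (v.residueCard : ℝ) ^ ((torusExponent mu : ℝ) - σ * ∑ i, (mu i : ℝ))) *
          ‖schurTrunc x mu‖ ^ 2 * (‖W g‖ ^ 2 * Φ (lastRow n K g) * torusWeight n K σ a) := by ring
    _ = ‖schurTrunc x mu‖ ^ 2 * (v.residueCard : ℝ) ^ (-(σ * ∑ i, (mu i : ℝ))) *
          (‖W g‖ ^ 2 * Φ (lastRow n K g) * torusWeight n K σ a) := by rw [hpow]; ring

end Pointwise

/-! ### Unit boxes in the torus and their translates -/

section Box

variable {n : ℕ} {K : Type} [Field K] [NumberField K]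

/-- The **unit box** of the torus off a set `G` of finite places: the `n`-tuples of ideles all of
whose entries are local units at every place of `G`. [folklore] -/
def unitBox (G : Set (HeightOneSpectrum (𝓞 K))) : Set (Fin n → ideleGroup K) :=
  {a | ∀ w ∈ G, ∀ i, Valued.v (((a i : ideleGroup K) : AdeleRing (𝓞 K) K).2 w) = 1}

/-- Unit boxes are antitone in the set of places. [folklore] -/
theorem unitBox_mono {G G' : Set (HeightOneSpectrum (𝓞 K))} (h : G ⊆ G') :
    unitBox (n := n) (K := K) G' ⊆ unitBox G :=
  fun _ ha w hw i => ha w (h hw) i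

/-- `‖y‖ = 1 ↔ |y|_w = 1` in `K_w` (Mathlib's norm on the completion is the rank-one norm of the
valuation). [folklore] -/
theorem norm_adicCompletion_eq_one_iff {w : HeightOneSpectrum (𝓞 K)} {y : w.adicCompletion K} :
    ‖y‖ = 1 ↔ Valued.v y = 1 := by
  rw [le_antisymm_iff, le_antisymm_iff, Valued.toNormedField.norm_le_one_iff,
    Valued.toNormedField.one_le_norm_iff]

/-- The unit box is closed (each condition `|a_{i,w}|_w = 1` is `‖a_{i,w}‖ = 1` for the continuous
map `a ↦ a_{i,w}`). [folklore] -/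
theorem isClosed_unitBox (G : Set (HeightOneSpectrum (𝓞 K))) : IsClosed (unitBox (n := n) (K := K) G) := by
  have h : unitBox (n := n) (K := K) G = ⋂ w ∈ G, ⋂ i : Fin n,
      {a | ‖AdelicGroupData.adeleEval K w ((a i : ideleGroup K) : AdeleRing (𝓞 K) K)‖ = 1} := by
    ext a
    simp only [unitBox, Set.mem_setOf_eq, Set.mem_iInter, norm_adicCompletion_eq_one_iff,
      AdelicGroupData.adeleEval_apply]
  rw [h]
  refine isClosed_biInter fun w _ => isClosed_iInter fun i => ?_
  exact isClosed_eq ((continuous_norm.comp ((AdelicGroupData.continuous_adeleEval K w).comp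
    (Units.continuous_val.comp (continuous_apply i))))) continuous_const

variable {v : HeightOneSpectrum (𝓞 K)} {ϖ : (v.adicCompletion K)ˣ}

/-- The `v`-valuations of the entries of `ϖ^μ a`: `exp(-μ_i)` for `a` in the unit box at `v`.
[folklore] -/
theorem valued_localTorusPow_mul_apply (hϖ : Valued.v (ϖ : v.adicCompletion K) = WithZero.exp (-1 : ℤ))
    (mu : Fin n → ℕ) {a : Fin n → ideleGroup K}
    (ha : ∀ i, Valued.v (((a i : ideleGroup K) : AdeleRing (𝓞 K) K).2 v) = 1) (i : Fin n) :
    Valued.v ((((localTorusPow ϖ mu * a) i : ideleGroup K) : AdeleRing (𝓞 K) K).2 v) =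
      WithZero.exp (-(mu i : ℤ)) := by
  have hmul : ((((localTorusPow ϖ mu * a) i : ideleGroup K) : AdeleRing (𝓞 K) K).2 v) =
      AdelicGroupData.adeleEval K v ((localTorusPow ϖ mu i : ideleGroup K) : AdeleRing (𝓞 K) K) *
        AdelicGroupData.adeleEval K v ((a i : ideleGroup K) : AdeleRing (𝓞 K) K) := by
    rw [Pi.mul_apply, Units.val_mul, ← map_mul]
    rfl
  rw [hmul, map_mul, AdelicGroupData.adeleEval_apply, AdelicGroupData.adeleEval_apply, ha i, mul_one,
    localTorusPow_snd_apply_self, Units.val_pow_eq_pow_val, map_pow, hϖ, ← WithZero.exp_nsmul]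
  simp

/-- Off `v`, the entries of `ϖ^μ a` have the valuations of those of `a`. [folklore] -/
theorem valued_localTorusPow_mul_apply_of_ne (mu : Fin n → ℕ) (a : Fin n → ideleGroup K)
    {w : HeightOneSpectrum (𝓞 K)} (hw : w ≠ v) (i : Fin n) :
    Valued.v ((((localTorusPow ϖ mu * a) i : ideleGroup K) : AdeleRing (𝓞 K) K).2 w) =
      Valued.v (((a i : ideleGroup K) : AdeleRing (𝓞 K) K).2 w) := by
  have hmul : ((((localTorusPow ϖ mu * a) i : ideleGroup K) : AdeleRing (𝓞 K) K).2 w) =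
      AdelicGroupData.adeleEval K w ((localTorusPow ϖ mu i : ideleGroup K) : AdeleRing (𝓞 K) K) *
        AdelicGroupData.adeleEval K w ((a i : ideleGroup K) : AdeleRing (𝓞 K) K) := by
    rw [Pi.mul_apply, Units.val_mul, ← map_mul]
    rfl
  rw [hmul, AdelicGroupData.adeleEval_apply, AdelicGroupData.adeleEval_apply,
    localTorusPow_snd_apply_of_ne ϖ mu i hw, one_mul]

/-- **The translates `ϖ_v^μ · B` of the unit box `B` at `v` and `G` lie in the unit box at `G`**
(`v ∉ G`). [folklore] -/
theorem localTorusPow_smul_unitBox_subset {G : Set (HeightOneSpectrum (𝓞 K))} (hv : v ∉ G)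
    (mu : Fin n → ℕ) :
    localTorusPow ϖ mu • unitBox (n := n) (insert v G) ⊆ unitBox G := by
  rintro _ ⟨a, ha, rfl⟩ w hw i
  have hwv : w ≠ v := fun h => hv (h ▸ hw)
  change Valued.v ((((localTorusPow ϖ mu * a) i : ideleGroup K) : AdeleRing (𝓞 K) K).2 w) = 1
  rw [valued_localTorusPow_mul_apply_of_ne mu a hwv]
  exact ha w (Set.mem_insert_of_mem _ hw) i

/-- **The translates `ϖ_v^μ · B` are pairwise disjoint** (the `v`-valuations of the entries recover
`μ`). [folklore] -/
theorem pairwise_disjoint_localTorusPow_smul_unitBox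
    (hϖ : Valued.v (ϖ : v.adicCompletion K) = WithZero.exp (-1 : ℤ)) (G : Set (HeightOneSpectrum (𝓞 K))) :
    Pairwise (Function.onFun Disjoint fun mu : Fin n → ℕ => localTorusPow ϖ mu • unitBox (n := n) (insert v G)) := by
  intro mu mu' hne
  refine Set.disjoint_left.2 ?_
  rintro _ ⟨a, ha, rfl⟩ ⟨a', ha', h⟩
  have h' : localTorusPow ϖ mu' * a' = localTorusPow ϖ mu * a := h
  apply hne
  funext i
  have h1 := valued_localTorusPow_mul_apply hϖ mu (fun j => ha v (Set.mem_insert _ _) j) i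
  have h2 := valued_localTorusPow_mul_apply hϖ mu' (fun j => ha' v (Set.mem_insert _ _) j) i
  rw [h', h1, WithZero.exp_inj, neg_inj, Nat.cast_inj] at h2
  exact h2

end Box

/-! ### The torus sum as a sum over weights -/

section TorusSum

variable {n : ℕ} {K : Type} [Field K] [NumberField K]

/-- **The local Rankin–Selberg coefficients sum to the torus sum**:
`∑_μ |s_μ(x)|² q_v^{-σ|μ|} = T_v(q_v^{-σ})`. [folklore] -/
theorem tsum_localCoeff (v : HeightOneSpectrum (𝓞 K)) (x : Fin n → ℂ) (σ : ℝ) :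
    ∑' mu : Fin n → ℕ, localCoeff v x σ mu = schurSelfSum x ((v.residueCard : ℝ) ^ (-σ)) := by
  have hq : (0 : ℝ) ≤ v.residueCard := Nat.cast_nonneg _
  rw [schurSelfSum_eq_tsum x]
  refine tsum_congr fun mu => ?_
  rw [localCoeff]
  congr 2
  rw [← Real.rpow_natCast, ← Real.rpow_mul hq, Nat.cast_sum, neg_mul]

end TorusSum

/-! ### The Euler lower bound -/

section LowerBound

variable {n : ℕ} {K : Type} [Field K] [NumberField K]
variable [MeasurableSpace (ideleGroup K)] [BorelSpace (ideleGroup K)]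

-- the house local instances of `SmoothedAutomorphicForms` / `GLnIwasawaIntegration` (Borel structure of
-- `GL_n(𝔸_K)`), and second countability of `𝔸_Kˣ` (`IdelicDyadicUnfolding`), needed for the Borel
-- structure of the finite product `(𝔸_Kˣ)ⁿ` (`Pi.borelSpace`); none overrides a Mathlib instance
attribute [local instance] adelicBorel borelSpace_adelic locallyCompactSpace_adelic
  secondCountableTopology_gl_adelic secondCountableTopology_ideleGroup

variable (νA : Measure (Fin n → ideleGroup K)) [νA.IsMulLeftInvariant] [SFinite νA]
  (νK : Measure ↥(maximalCompactAdelic n K)) [SFinite νK]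

/-- The unit box is measurable. [folklore] -/
theorem measurableSet_unitBox (G : Set (HeightOneSpectrum (𝓞 K))) :
    MeasurableSet (unitBox (n := n) (K := K) G) :=
  (isClosed_unitBox G).measurableSet

/-- Translates of the unit box are measurable. [folklore] -/
theorem measurableSet_smul_unitBox (t : Fin n → ideleGroup K) (G : Set (HeightOneSpectrum (𝓞 K))) :
    MeasurableSet (t • unitBox (n := n) (K := K) G) := by
  rw [← Set.image_smul, show (fun x => t • x) = ⇑(MeasurableEquiv.mulLeft t) from
    (MeasurableEquiv.coe_mulLeft t).symm]
  exact (MeasurableEquiv.mulLeft t).measurableSet_image.2 (measurableSet_unitBox G)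

variable {v : HeightOneSpectrum (𝓞 K)} {ϖ : (v.adicCompletion K)ˣ} {x : Fin n → ℂ}
  {W : GL (Fin n) (AdeleRing (𝓞 K) K) → ℂ} {Φ : (Fin n → AdeleRing (𝓞 K) K) → ℝ}

/-- **The integral over a translate of the unit box.** Translating the torus variable by `ϖ_v^μ`
multiplies the integral of the Rankin–Selberg integrand over `B × K`, `B` the unit box at `v` and
`G`, by the local coefficient `|s_μ(x)|² q_v^{-σ|μ|}`: the Haar measure of the torus is left invariant
and the integrand transforms by `torusIntegrand_localTorusPow_mul`. [folklore] -/
theorem setLIntegral_smul_unitBox_eq (hW : IsTorusUnramifiedAt n K W v ϖ x)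
    (hΦ : IsLastRowSphericalAt n K Φ v) (σ : ℝ) (G : Set (HeightOneSpectrum (𝓞 K))) (mu : Fin n → ℕ) :
    ∫⁻ p in (localTorusPow ϖ mu • unitBox (insert v G)) ×ˢ Set.univ, torusIntegrand n K W Φ σ p
        ∂(νA.prod νK) =
      localCoeff v x σ mu *
        ∫⁻ p in unitBox (insert v G) ×ˢ Set.univ, torusIntegrand n K W Φ σ p ∂(νA.prod νK) := by
  set t := localTorusPow (n := n) ϖ mu with ht
  set B := unitBox (n := n) (K := K) (insert v G) with hB
  let e : (Fin n → ideleGroup K) × ↥(maximalCompactAdelic n K) ≃ᵐ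
      (Fin n → ideleGroup K) × ↥(maximalCompactAdelic n K) :=
    (MeasurableEquiv.mulLeft t).prodCongr (MeasurableEquiv.refl _)
  have he : ⇑e = Prod.map (t * ·) id := rfl
  have hmp : MeasurePreserving e (νA.prod νK) (νA.prod νK) := by
    rw [he]
    exact (measurePreserving_mul_left νA t).prod (MeasurePreserving.id νK)
  have hpre : e ⁻¹' ((t • B) ×ˢ Set.univ) = B ×ˢ Set.univ := by
    ext p
    simp only [he, Set.mem_preimage, Set.mem_prod, Set.mem_univ, and_true, Prod.map_fst]
    exact Set.smul_mem_smul_set_iff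
  calc ∫⁻ p in (t • B) ×ˢ Set.univ, torusIntegrand n K W Φ σ p ∂(νA.prod νK)
      = ∫⁻ p in e ⁻¹' ((t • B) ×ˢ Set.univ), torusIntegrand n K W Φ σ (e p) ∂(νA.prod νK) :=
        (hmp.setLIntegral_comp_preimage_emb e.measurableEmbedding _ _).symm
    _ = ∫⁻ p in B ×ˢ Set.univ, torusIntegrand n K W Φ σ (t * p.1, p.2) ∂(νA.prod νK) := by
        rw [hpre]
        rfl
    _ = ∫⁻ p in B ×ˢ Set.univ, localCoeff v x σ mu * torusIntegrand n K W Φ σ p ∂(νA.prod νK) := by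
        refine setLIntegral_congr_fun ((measurableSet_unitBox _).prod MeasurableSet.univ) fun p hp => ?_
        exact torusIntegrand_localTorusPow_mul hW hΦ σ mu
          (fun i => hp.1 v (Set.mem_insert v G) i) p.2
    _ = localCoeff v x σ mu * ∫⁻ p in B ×ˢ Set.univ, torusIntegrand n K W Φ σ p ∂(νA.prod νK) :=
        lintegral_const_mul' _ _ ENNReal.ofReal_ne_top

/-- **One Euler factor.** For `v ∉ G`:
`T_v(q_v^{-σ}) · ∫_{B(insert v G) × K} ≤ ∫_{B(G) × K}` — the translates `ϖ_v^μ B(insert v G)`,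
`μ ∈ ℕⁿ`, are disjoint subsets of `B(G)` on which the integrand is `|s_μ(x)|² q_v^{-σ|μ|}` times
its value on `B(insert v G)`, and `∑_μ |s_μ(x)|² q_v^{-σ|μ|} = T_v(q_v^{-σ})` (Tonelli).
[folklore] -/
theorem schurSelfSum_mul_setLIntegral_le (hW : IsTorusUnramifiedAt n K W v ϖ x)
    (hΦ : IsLastRowSphericalAt n K Φ v) (σ : ℝ) {G : Set (HeightOneSpectrum (𝓞 K))} (hv : v ∉ G) :
    schurSelfSum x ((v.residueCard : ℝ) ^ (-σ)) *
        ∫⁻ p in unitBox (insert v G) ×ˢ Set.univ, torusIntegrand n K W Φ σ p ∂(νA.prod νK) ≤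
      ∫⁻ p in unitBox G ×ˢ Set.univ, torusIntegrand n K W Φ σ p ∂(νA.prod νK) := by
  rw [← tsum_localCoeff v x σ, ← ENNReal.tsum_mul_right]
  simp_rw [← setLIntegral_smul_unitBox_eq νA νK hW hΦ σ G]
  rw [← lintegral_iUnion (fun mu => (measurableSet_smul_unitBox _ _).prod MeasurableSet.univ)
    (fun mu mu' hne => Set.disjoint_prod.2 (Or.inl
      (pairwise_disjoint_localTorusPow_smul_unitBox hW.valued_eq G hne)))]
  exact lintegral_mono_set (Set.iUnion_subset fun mu =>
    Set.prod_mono (localTorusPow_smul_unitBox_subset hv mu) subset_rfl)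

variable {ϖ : ∀ v : HeightOneSpectrum (𝓞 K), (v.adicCompletion K)ˣ}
  {x : HeightOneSpectrum (𝓞 K) → Fin n → ℂ}

/-- **The Euler lower bound on the unit boxes.** If `W` is an unramified Whittaker–Hecke datum and `Φ`
is spherical at every place of a set `Good`, then for every finite `F ⊆ Good`,
`(∏_{v ∈ F} T_v(q_v^{-σ})) · ∫_{B(Good) × K} ≤ ∫_{B(Good ∖ F) × K}` (induction on `F`, one Euler
factor at a time: `schurSelfSum_mul_setLIntegral_le`). [folklore] -/
theorem prod_schurSelfSum_mul_setLIntegral_le {Good : Set (HeightOneSpectrum (𝓞 K))}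
    (hW : ∀ v ∈ Good, IsTorusUnramifiedAt n K W v (ϖ v) (x v))
    (hΦ : ∀ v ∈ Good, IsLastRowSphericalAt n K Φ v) (σ : ℝ) (F : Finset (HeightOneSpectrum (𝓞 K)))
    (hF : (↑F : Set (HeightOneSpectrum (𝓞 K))) ⊆ Good) :
    (∏ v ∈ F, schurSelfSum (x v) ((v.residueCard : ℝ) ^ (-σ))) *
        ∫⁻ p in unitBox Good ×ˢ Set.univ, torusIntegrand n K W Φ σ p ∂(νA.prod νK) ≤
      ∫⁻ p in unitBox (Good \ ↑F) ×ˢ Set.univ, torusIntegrand n K W Φ σ p ∂(νA.prod νK) := by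
  classical
  induction F using Finset.induction_on with
  | empty => simp
  | insert v F hvF ih =>
    have hv : v ∈ Good := hF (Finset.mem_coe.2 (Finset.mem_insert_self v F))
    have hF' : (↑F : Set (HeightOneSpectrum (𝓞 K))) ⊆ Good := fun w hw =>
      hF (Finset.mem_coe.2 (Finset.mem_insert_of_mem (Finset.mem_coe.1 hw)))
    rw [Finset.prod_insert hvF, mul_assoc]
    refine (mul_le_mul_right (ih hF') _).trans ?_
    have hset : Good \ ↑F = insert v (Good \ ↑(insert v F)) := by
      ext w
      by_cases hw : w = v
      · subst hw
        simp [hv, hvF]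
      · simp [hw]
    rw [hset]
    exact schurSelfSum_mul_setLIntegral_le νA νK (hW v hv) (hΦ v hv) σ (by simp)

/-- **The Euler lower bound for the unfolded Rankin–Selberg integral at a real point.** For every
finite set `F` of good places,
`(∏_{v ∈ F} T_v(q_v^{-σ})) · c ≤ Ψ(σ) = rankinSelbergTorusIntegral νA νK W Φ σ`
with `c = ∫_{B(Good) × K} |W(diag(a) k)|² Φ(e_n diag(a) k) |det a|^σ δ_B(a)⁻¹` — a constant which does
**not** depend on `F`. This is the positivity skeleton of the Euler factorisation
`Ψ = ∏_v Ψ_v`, `Ψ_v = T_v(q_v^{-s})` for unramified `v` (Jacquet–Shalika (1981), §2 Prop. (2.3)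
and §4; Cogdell (2004), Thm. 2.2 and Thm. 3.3), at a real point and as an inequality in `[0, ∞]`,
which needs neither the factorisation of `W` nor any convergence.
[cite: JacquetShalikaAJM1981, §2 Prop. (2.3), §4] -/
theorem prod_schurSelfSum_mul_setLIntegral_le_rankinSelbergTorusIntegral
    {Good : Set (HeightOneSpectrum (𝓞 K))} (hW : ∀ v ∈ Good, IsTorusUnramifiedAt n K W v (ϖ v) (x v))
    (hΦ : ∀ v ∈ Good, IsLastRowSphericalAt n K Φ v) (σ : ℝ) (F : Finset (HeightOneSpectrum (𝓞 K)))
    (hF : (↑F : Set (HeightOneSpectrum (𝓞 K))) ⊆ Good) :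
    (∏ v ∈ F, schurSelfSum (x v) ((v.residueCard : ℝ) ^ (-σ))) *
        ∫⁻ p in unitBox Good ×ˢ Set.univ, torusIntegrand n K W Φ σ p ∂(νA.prod νK) ≤
      rankinSelbergTorusIntegral n K νA νK W Φ σ :=
  (prod_schurSelfSum_mul_setLIntegral_le νA νK hW hΦ σ F hF).trans (setLIntegral_le_lintegral _ _)

/-- **Finiteness of the unfolded integral bounds the Euler partial products.** If
`Ψ(σ) = rankinSelbergTorusIntegral νA νK W Φ σ < ∞` and the unit-box integral `c` is positive, then
all partial products `∏_{v ∈ F} T_v(q_v^{-σ})` over finite sets of good places are bounded by the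
finite constant `Ψ(σ) / c` — the shape of `JacquetShalika1981_schurSelfSum_prod_bounded`
(`JacquetShalikaSchurSelfSum`), which is equivalent in the tree to (5.3.3)–(5.3.4) and to
Lemma (5.2) of Jacquet–Shalika (1981). [cite: JacquetShalikaAJM1981, Lemma (5.2), Thm. (5.3)] -/
theorem exists_prod_schurSelfSum_le_of_rankinSelbergTorusIntegral_ne_top
    {Good : Set (HeightOneSpectrum (𝓞 K))} (hW : ∀ v ∈ Good, IsTorusUnramifiedAt n K W v (ϖ v) (x v))
    (hΦ : ∀ v ∈ Good, IsLastRowSphericalAt n K Φ v) {σ : ℝ}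
    (hfin : rankinSelbergTorusIntegral n K νA νK W Φ σ ≠ ⊤)
    (hpos : ∫⁻ p in unitBox Good ×ˢ Set.univ, torusIntegrand n K W Φ σ p ∂(νA.prod νK) ≠ 0) :
    ∃ C : ℝ≥0∞, C ≠ ⊤ ∧ ∀ F : Finset (HeightOneSpectrum (𝓞 K)),
      (↑F : Set (HeightOneSpectrum (𝓞 K))) ⊆ Good →
        ∏ v ∈ F, schurSelfSum (x v) ((v.residueCard : ℝ) ^ (-σ)) ≤ C := by
  refine ⟨rankinSelbergTorusIntegral n K νA νK W Φ σ /
      ∫⁻ p in unitBox Good ×ˢ Set.univ, torusIntegrand n K W Φ σ p ∂(νA.prod νK),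
    ENNReal.div_ne_top hfin hpos, fun F hF => ?_⟩
  rw [ENNReal.le_div_iff_mul_le (Or.inl hpos) (Or.inr hfin)]
  exact prod_schurSelfSum_mul_setLIntegral_le_rankinSelbergTorusIntegral νA νK hW hΦ σ F hF

end LowerBound

/-! ### The standard test function `Φ_∞ ⊗ 𝟙_{𝒪̂ⁿ}` -/

section Standard

variable (n : ℕ) (K : Type) [Field K] [NumberField K]

open scoped Classical in
/-- The **standard Rankin–Selberg test function** `Φ(y) = Φ_∞(y_∞) · 𝟙_{𝒪̂ⁿ}(y_f)` on `𝔸_Kⁿ` built from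
an archimedean function `Φ_∞` (in the application a Gaussian): the factorizable Schwartz–Bruhat
function with `Φ_v = 𝟙_{𝒪_vⁿ}` at **every** finite place (Jacquet–Shalika (1981), (5.1): `Φ`
unramified outside `S`; Cogdell (2004), §2.3). [folklore] -/
def standardTestFun (Φinf : (Fin n → InfiniteAdeleRing K) → ℝ) (y : Fin n → AdeleRing (𝓞 K) K) : ℝ :=
  if ∀ (i : Fin n) (w : HeightOneSpectrum (𝓞 K)), (y i).2 w ∈ w.adicCompletionIntegers K
    then Φinf (fun i => (y i).1) else 0

variable {n K}

/-- The standard test function is non-negative if `Φ_∞` is. [folklore] -/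
theorem standardTestFun_nonneg {Φinf : (Fin n → InfiniteAdeleRing K) → ℝ} (h : ∀ z, 0 ≤ Φinf z)
    (y : Fin n → AdeleRing (𝓞 K) K) : 0 ≤ standardTestFun n K Φinf y := by
  unfold standardTestFun
  split_ifs
  · exact h _
  · exact le_rfl

/-- **The standard test function is spherical at every finite place.** [folklore] -/
theorem isLastRowSphericalAt_standardTestFun (Φinf : (Fin n → InfiniteAdeleRing K) → ℝ)
    (v : HeightOneSpectrum (𝓞 K)) : IsLastRowSphericalAt n K (standardTestFun n K Φinf) v := by
  classical
  refine ⟨fun c y hc1 hcw hcv _ hy => ?_⟩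
  have hfst : (fun i => ((c • y) i).1) = fun i => (y i).1 := by
    funext i
    rw [Pi.smul_apply, smul_eq_mul, show (c * y i).1 = c.1 * (y i).1 from rfl, hc1, one_mul]
  have hsnd : ∀ i w, ((c • y) i).2 w = c.2 w * (y i).2 w := fun i w => rfl
  have hiff : (∀ (i : Fin n) (w : HeightOneSpectrum (𝓞 K)), ((c • y) i).2 w ∈ w.adicCompletionIntegers K) ↔
      ∀ (i : Fin n) (w : HeightOneSpectrum (𝓞 K)), (y i).2 w ∈ w.adicCompletionIntegers K := by
    refine forall_congr' fun i => forall_congr' fun w => ?_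
    rw [hsnd]
    by_cases hw : w = v
    · subst hw
      rw [HeightOneSpectrum.mem_adicCompletionIntegers, HeightOneSpectrum.mem_adicCompletionIntegers,
        map_mul]
      exact ⟨fun _ => hy i, fun h => mul_le_one' hcv h⟩
    · rw [hcw w hw, one_mul]
  unfold standardTestFun
  rw [hfst]
  simp only [hiff]

end Standard

/-! ### Instantiation: Whittaker coefficients of smoothed cuspidal vectors -/

section Cuspidal

open ValuativeRel

variable {n : ℕ} {K : Type} [Field K] [NumberField K]
  {μ : Measure (AdelicGroupData.gl n K).automorphicQuotient}
  [(AdelicGroupData.gl n K).IsAutomorphicMeasure μ]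
variable [MeasurableSpace ↥(adelicUnipotent n K)] [BorelSpace ↥(adelicUnipotent n K)]
  [MeasurableConstSMul ↥(rationalUnipotent n K) ↥(adelicUnipotent n K)]
  {ν : Measure ↥(adelicUnipotent n K)} [IsFiniteMeasureOnCompacts ν]
  [SMulInvariantMeasure ↥(rationalUnipotent n K) ↥(adelicUnipotent n K) ν] [ν.IsMulRightInvariant]
  {𝓕 : Set ↥(adelicUnipotent n K)} {ψ : AddChar (AdeleRing (𝓞 K) K) Circle}

/-- **The global Whittaker coefficient of a smoothed cuspidal vector is an unramified torus datum at
every good place.** Let `Π` be a cuspidal automorphic representation of `GL_n(𝔸_K)` with Satake family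
`α` off `S`, `f ∈ Π`, `η` a continuous compactly supported left `K(𝔫₀)`-invariant weight (`𝔫₀ ≠ 0`),
`φ = invQuot (S_η f)`, `ψ` a global additive character, `𝓕` a relatively compact fundamental domain of
`N_n(K)` in `N_n(𝔸_K)`; let `v ∉ S`, `v ∤ 𝔫₀`, with `ψ_v` of conductor `𝒪_v`, and `x` an enumeration of
`α v`. Then for the uniformizer `ϖ` of the Satake datum, `W_φ` is an unramified Whittaker–Hecke datum
at `v` in the torus sense (`IsTorusUnramifiedAt`): sphericity by the level of `S_η f`, Shintani's
formula and the vanishing off the antitone cone by `WhittakerCoeffLocalDatum`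
(`whittakerCoeff_ofLocal_piPowGL_eq`, `…_eq_zero`) fed with the pointwise Hecke equations of
`WhittakerCoeffCuspidal` and `#𝓀_v = q_v` (`AdicCompletionResidueCard`).
[cite: Shintani1976, Theorem (p. 181)] -/
theorem exists_isTorusUnramifiedAt_whittakerCoeff_smoothedForm (P : CuspidalAutomorphicRepGL n K μ)
    {S : Set (HeightOneSpectrum (𝓞 K))} {α : SatakeFamily K} (hα : IsSatakeFamilyOf P S α)
    {𝔫₀ : Ideal (𝓞 K)} (h𝔫₀ : 𝔫₀ ≠ 0) {v : HeightOneSpectrum (𝓞 K)} (hvS : v ∉ S)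
    (hv : ¬ v.asIdeal ∣ 𝔫₀) {η : (AdelicGroupData.gl n K).Adelic → ℝ} (hη : Continuous η)
    (hηs : HasCompactSupport η)
    (hηK : ∀ k : (AdelicGroupData.gl n K).Adelic, k ∈ principalCongruenceLevel n K 𝔫₀ →
      ∀ g : (AdelicGroupData.gl n K).Adelic, η (k * g) = η g)
    (f : P.1.toSubmodule) {x : Fin n → ℂ} (hx : (Finset.univ : Finset (Fin n)).val.map x = α v)
    (h𝓕 : IsFundamentalDomain ↥(rationalUnipotent n K) 𝓕 ν) (h𝓕c : IsCompact (closure 𝓕))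
    (hψ : IsGlobalAddChar K ψ) (hψv : ∀ c ∈ 𝒪[v.adicCompletion K], ψ.adicComponent v c = 1)
    (hψv' : ∀ ϖ : v.adicCompletion K, Valued.v ϖ = WithZero.exp (-1 : ℤ) →
      ∃ c ∈ 𝒪[v.adicCompletion K], ψ.adicComponent v (ϖ⁻¹ * c) ≠ 1) :
    ∃ ϖ : (v.adicCompletion K)ˣ, IsTorusUnramifiedAt n K
      (whittakerCoeff ν 𝓕 ψ
        (invQuot (AdelicGroupData.gl n K) (smoothedForm η (f : (AdelicGroupData.gl n K).L2 μ)))) v ϖ x := by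
  obtain ⟨ϖ, hϖ, hT⟩ := sum_invQuot_smoothedForm_mul_ofLocal_rep_eq P hα h𝔫₀ hvS hv hη hηs hηK f hx
  set φ : GL (Fin n) (AdeleRing (𝓞 K) K) → ℂ :=
    invQuot (AdelicGroupData.gl n K) (smoothedForm η (f : (AdelicGroupData.gl n K).L2 μ)) with hφ
  have hφK : ∀ k ∈ glInt n (v.adicCompletion K), ∀ y : GL (Fin n) (AdeleRing (𝓞 K) K),
      φ (y * GLn.ofLocal n K v k) = φ y :=
    fun k hk y => invQuot_smoothedForm_mul_ofLocal h𝔫₀ hv hηK _ hk y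
  have hint : ∀ g, IntegrableOn (fun u : ↥(adelicUnipotent n K) =>
      φ ((u : GL (Fin n) (AdeleRing (𝓞 K) K)) * g) * conj (whittakerCharFun ψ u)) 𝓕 ν := fun g =>
    integrableOn_whittakerIntegrand_of_continuous h𝓕c hψ.continuous
      (continuous_invQuot_smoothedForm hη hηs _) g
  have hs : (((Real.sqrt (v.residueCard : ℝ) : ℝ) : ℂ)) ≠ 0 := by
    rw [Complex.ofReal_ne_zero, Real.sqrt_ne_zero']
    exact_mod_cast zero_lt_one.trans v.one_lt_residueCard
  have hq' : ((Nat.card 𝓀[v.adicCompletion K] : ℕ) : ℂ) =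
      (((Real.sqrt (v.residueCard : ℝ) : ℝ) : ℂ)) ^ 2 := by
    rw [natCard_valuativeResidueField_adicCompletion_eq, ← Complex.ofReal_pow,
      Real.sq_sqrt (Nat.cast_nonneg _), Complex.ofReal_natCast]
  obtain ⟨c, hc, hcne⟩ := hψv' ϖ hϖ
  refine ⟨ϖ, hϖ, fun k hk g => whittakerCoeff_mul_of_forall ν 𝓕 ψ (hφK k hk) g, fun g hg mu => ?_⟩
  by_cases hmu : Antitone mu
  · rw [schurTrunc, if_pos hmu]
    exact whittakerCoeff_ofLocal_piPowGL_eq h𝓕 hψ (isLeftInvariant_invQuot _ _) hφK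
      (isUniformizingElement_of_valued_eq K v hϖ) hT hint hg hψv ⟨c, hc, hcne⟩ hs hq' hmu
  · rw [schurTrunc, if_neg hmu, mul_zero, zero_mul]
    exact whittakerCoeff_ofLocal_piPowGL_eq_zero h𝓕 hψ (isLeftInvariant_invQuot _ _) hφK
      (isUniformizingElement_of_valued_eq K v hϖ) hT hint hg ⟨c, hc, hcne⟩ hmu

end Cuspidal

section CuspidalBound

open ValuativeRel

variable {n : ℕ} {K : Type} [Field K] [NumberField K]
  {μ : Measure (AdelicGroupData.gl n K).automorphicQuotient}
  [(AdelicGroupData.gl n K).IsAutomorphicMeasure μ]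
variable [MeasurableSpace ↥(adelicUnipotent n K)] [BorelSpace ↥(adelicUnipotent n K)]
  [MeasurableConstSMul ↥(rationalUnipotent n K) ↥(adelicUnipotent n K)]
  {ν : Measure ↥(adelicUnipotent n K)} [IsFiniteMeasureOnCompacts ν]
  [SMulInvariantMeasure ↥(rationalUnipotent n K) ↥(adelicUnipotent n K) ν] [ν.IsMulRightInvariant]
  {𝓕 : Set ↥(adelicUnipotent n K)} {ψ : AddChar (AdeleRing (𝓞 K) K) Circle}
variable [MeasurableSpace (ideleGroup K)] [BorelSpace (ideleGroup K)]

attribute [local instance] adelicBorel borelSpace_adelic locallyCompactSpace_adelic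
  secondCountableTopology_gl_adelic

/-- **The Euler partial products of a cuspidal representation are bounded by its unfolded
Rankin–Selberg integral.** Let `Π` be a cuspidal automorphic representation of `GL_n(𝔸_K)` with
Satake family `α` off `S`, `f ∈ Π`, `η` a left `K(𝔫₀)`-invariant test weight, `φ = invQuot (S_η f)`,
`W = W_φ` its global Whittaker coefficient, `Φ = Φ_∞ ⊗ 𝟙_{𝒪̂ⁿ}`, and `Good` a set of finite places
`v ∉ S`, `v ∤ 𝔫₀` at which `ψ_v` has conductor `𝒪_v`, with enumerations `x v` of `α v`. If for a real
`σ` the unfolded integral `Ψ(σ) = rankinSelbergTorusIntegral νA νK W Φ σ` is finite and the unit-box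
integral over `B(Good) × K` is positive, then the partial products `∏_{v ∈ F} T_v(q_v^{-σ})` of the
unramified Rankin–Selberg torus sums over finite `F ⊆ Good` are bounded by a finite constant — the
hypothesis shape of `JacquetShalika1981_schurSelfSum_prod_bounded` (`JacquetShalikaSchurSelfSum`) for
`Π`, i.e. of Jacquet–Shalika's (5.3.3)–(5.3.4) and Lemma (5.2) in the tree.
[cite: JacquetShalikaAJM1981, Lemma (5.2), Thm. (5.3)] -/
theorem exists_prod_schurSelfSum_le_of_cuspidal (P : CuspidalAutomorphicRepGL n K μ)
    {S : Set (HeightOneSpectrum (𝓞 K))} {α : SatakeFamily K} (hα : IsSatakeFamilyOf P S α)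
    {𝔫₀ : Ideal (𝓞 K)} (h𝔫₀ : 𝔫₀ ≠ 0) {η : (AdelicGroupData.gl n K).Adelic → ℝ} (hη : Continuous η)
    (hηs : HasCompactSupport η)
    (hηK : ∀ k : (AdelicGroupData.gl n K).Adelic, k ∈ principalCongruenceLevel n K 𝔫₀ →
      ∀ g : (AdelicGroupData.gl n K).Adelic, η (k * g) = η g)
    (f : P.1.toSubmodule) (h𝓕 : IsFundamentalDomain ↥(rationalUnipotent n K) 𝓕 ν)
    (h𝓕c : IsCompact (closure 𝓕)) (hψ : IsGlobalAddChar K ψ) {Good : Set (HeightOneSpectrum (𝓞 K))}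
    (hGood : ∀ v ∈ Good, v ∉ S ∧ ¬ v.asIdeal ∣ 𝔫₀ ∧
      (∀ c ∈ 𝒪[v.adicCompletion K], ψ.adicComponent v c = 1) ∧
      ∀ ϖ : v.adicCompletion K, Valued.v ϖ = WithZero.exp (-1 : ℤ) →
        ∃ c ∈ 𝒪[v.adicCompletion K], ψ.adicComponent v (ϖ⁻¹ * c) ≠ 1)
    {x : HeightOneSpectrum (𝓞 K) → Fin n → ℂ}
    (hx : ∀ v ∈ Good, (Finset.univ : Finset (Fin n)).val.map (x v) = α v)
    (Φinf : (Fin n → InfiniteAdeleRing K) → ℝ) {σ : ℝ}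
    (νA : Measure (Fin n → ideleGroup K)) [νA.IsMulLeftInvariant] [SFinite νA]
    (νK : Measure ↥(maximalCompactAdelic n K)) [SFinite νK]
    (hfin : rankinSelbergTorusIntegral n K νA νK
      (whittakerCoeff ν 𝓕 ψ
        (invQuot (AdelicGroupData.gl n K) (smoothedForm η (f : (AdelicGroupData.gl n K).L2 μ))))
      (standardTestFun n K Φinf) σ ≠ ⊤)
    (hpos : ∫⁻ p in unitBox Good ×ˢ Set.univ, torusIntegrand n K
      (whittakerCoeff ν 𝓕 ψ
        (invQuot (AdelicGroupData.gl n K) (smoothedForm η (f : (AdelicGroupData.gl n K).L2 μ))))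
      (standardTestFun n K Φinf) σ p ∂(νA.prod νK) ≠ 0) :
    ∃ C : ℝ≥0∞, C ≠ ⊤ ∧ ∀ F : Finset (HeightOneSpectrum (𝓞 K)),
      (↑F : Set (HeightOneSpectrum (𝓞 K))) ⊆ Good →
        ∏ v ∈ F, schurSelfSum (x v) ((v.residueCard : ℝ) ^ (-σ)) ≤ C := by
  classical
  -- choose the uniformizers of the Satake data at the good places
  have hex : ∀ v ∈ Good, ∃ ϖ : (v.adicCompletion K)ˣ, IsTorusUnramifiedAt n K
      (whittakerCoeff ν 𝓕 ψ
        (invQuot (AdelicGroupData.gl n K) (smoothedForm η (f : (AdelicGroupData.gl n K).L2 μ))))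
      v ϖ (x v) := fun v hv =>
    exists_isTorusUnramifiedAt_whittakerCoeff_smoothedForm P hα h𝔫₀ (hGood v hv).1 (hGood v hv).2.1
      hη hηs hηK f (hx v hv) h𝓕 h𝓕c hψ (hGood v hv).2.2.1 (hGood v hv).2.2.2
  let ϖ : ∀ v : HeightOneSpectrum (𝓞 K), (v.adicCompletion K)ˣ := fun v =>
    if hv : v ∈ Good then Classical.choose (hex v hv) else 1
  have hW : ∀ v ∈ Good, IsTorusUnramifiedAt n K
      (whittakerCoeff ν 𝓕 ψ
        (invQuot (AdelicGroupData.gl n K) (smoothedForm η (f : (AdelicGroupData.gl n K).L2 μ))))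
      v (ϖ v) (x v) := fun v hv => by
    simp only [ϖ, dif_pos hv]
    exact Classical.choose_spec (hex v hv)
  exact exists_prod_schurSelfSum_le_of_rankinSelbergTorusIntegral_ne_top νA νK hW
    (fun v _ => isLastRowSphericalAt_standardTestFun Φinf v) hfin hpos

end CuspidalBound

end Literature.NumberTheory.Automorphic
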